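import Summits.HodgeConjecture.HodgeConjecture.Theorems.R90S1SplitOpenCellRootBoxes
import HarnessLib

/-!
# R90-TF · S1 «Ch10-local» · split place, ROAD β — the open `Q_{2,1}`-orbit contributes nothing to the
# `U_P`-coinvariants of `Ind_{Q_{2,1}}^{GL₃} σ'` when `σ'` is cuspidal along the Levi root group `u₁₀(F)`

Cell `hodgecm-mathlib`, programme R90-TF, section S1, crux H413 (`stmt-HodgeConjecture-24833`), route `HCCMUnconditional`;
prover seat R90-C10-p02, socket S1#7 `SocketSplitInducedIrreducible` (TOP of `Cruxes/H413/Lines/R90_S1_SplitLocalPacketsB.lean`),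
ROAD β «BY SUPPORT OF σ» — first organ: the SUPERCUSPIDAL branch of the Mackey / geometric-lemma computation of
`End_{GL₃}(n-Ind_{P(2,1)}(σ ⊠ χ′))`.  THEOREMS ONLY (no `def`, no instance, no notation, no `sorry`); ONE public theorem;
lane `--supports stmt-HodgeConjecture-24833`.

THE MATHEMATICS ([BernsteinZelevinskyASENS1977, Thm. 5.2 for the pair `(Q_{2,1}, Q_{2,1})`, §7.1]; [Casselman1995, §6.3]).
`P = Q_{2,1} = M U_P ≤ G = GL₃(F)`, `M = GL₂ × GL₁`, `σ'` a smooth representation of `P` on `W`, `I = Ind_P^G σ'` (★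
`Representation.smoothIndRep`).  The Jacquet module `r_P(I) = I_{U_P}` is glued from the closed orbit (`≅ σ'`, via `f ↦ f(1)`) and the
open orbit `P w₀ N'` (`N' ≅ F²`, coordinates `(z₁, z₂)` = first row `(1, z₁, z₂)` of `n'`); on the latter `U_P` acts by
`(u₀₂(a) f)(w₀ n'(z)) = f(w₀ n'(z₁, z₂ + a))` and `(u₁₂(b) f)(w₀ n'(z)) = σ'(u₁₀(b)) f(w₀ n'(z₁, z₂ + z₁ b))` — the cocycle
`w₀ u₁₂(b) w₀⁻¹ = u₁₀(b)` lands in the root group of the `GL₂`-block OPPOSITE to the standard one — so that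
`(I_open)_{U_P} ≅ C_c^∞(F, W_{u₁₀(F)})`, the open-orbit term `i ∘ w ∘ r(σ')` of the geometric lemma.  Hence: **if the Jacquet
module of `σ'` along `u₁₀(F)` vanishes, every `f ∈ I_open` has class `0` in `I_{U_P}`.**  Proof on standard sections (no Haar
measure): `f = ∑_r r⁻¹ · Φ_{K_γ, w_r}` (★ `exists_eq_sum_cellSection`, `K_γ = N' ∩ K_{ϖ^m}` the level of `f`); for a translate
`s · Φ_{K_γ, w}` write `w = ∑ cᵢ (σ'(u₁₀ bᵢ) yᵢ - yᵢ)`, lengthen the box to `K(γ, γ|t|⁻¹)` with `v(bᵢ t) ≤ 1` (index `N`, cosets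
represented in `U_P`, so the class is multiplied by `N ≠ 0`), where `u₁₂(bᵢ)` normalises the box and ★ `smoothIndRep_levi_cellSection`
gives `u₁₂(b) · Φ_{K,y} = Φ_{K, σ'(u₁₀ b) y}`; as `u₁₂(b), u₀₂(a) ∈ U_P` act trivially on classes, `[s · Φ_{K, σ'(u₁₀ b) y - y}] = 0`.

Consumer: `R90S1SplitInducedEndScalarOfCuspidal` (`End_{GL₃}(n-Ind(σ ⊠ χ′)) = ℂ` for `σ` supercuspidal) and any later
`Hom_P(I|_P, τ)` computation.  HONEST LABEL: an organ of S1#7, not the socket; HC_CM is proved only modulo the 7 printed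
citations (2 remaining named inputs: hLiu418 = stmt-HodgeConjecture-24832, h413 = stmt-HodgeConjecture-24833) until rung 0 closes.

## References
* [BernsteinZelevinskyASENS1977] I. N. Bernstein, A. V. Zelevinsky, *Induced representations of reductive p-adic groups I*,
  Ann. Sci. ÉNS 10 (1977), Thm. 5.2 (geometric lemma), §7.1.
* [BernsteinZelevinskyRMS1976] I. N. Bernstein, A. V. Zelevinsky, *Representations of the group GL(n,F) where F is a
  non-archimedean local field*, Russian Math. Surveys 31:3 (1976), §2.22–2.24, 2.33.
* [Casselman1995] W. Casselman, *Introduction to the theory of admissible representations of p-adic reductive groups* (1995),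
  Prop. 6.3.1–6.3.3.
-/

set_option autoImplicit false
set_option linter.dupNamespace false

noncomputable section

open Matrix Literature.LinearAlgebra.Matrix.DiagonalTorus
open Literature.NumberTheory.Automorphic Literature.NumberTheory.Automorphic.Zelevinsky1980
open ValuativeRel
open Summit.HodgeConjecture.HodgeConjecture.R90.S1.SplitCell

namespace Summit.HodgeConjecture.HodgeConjecture.R90.S1

variable {F : Type*} [Field F]

/-! ## §3 The open-orbit classes in the `U_P`-coinvariants -/

section Coinvariants

variable [ValuativeRel F] [TopologicalSpace F] [IsNonarchimedeanLocalField F]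
  {W : Type*} [AddCommGroup W] [Module ℂ W]
  (σ' : Representation ℂ ↥(standardParabolicGL F (lastBlockLabel 3)) W) (hσ' : σ'.IsSmooth)

/-- Right translation by an element of `K` fixes the standard section `Φ_{K,w}`. [cite: BernsteinZelevinskyRMS1976, §2.22] -/
private theorem smoothIndRep_cellSection_of_mem
    (K : Subgroup ↥(oppositeCellRadical (K := F) (lastBlockLabel 3)))
    (hKo : IsOpen (K : Set ↥(oppositeCellRadical (K := F) (lastBlockLabel 3))))
    (hKc : IsCompact (K : Set ↥(oppositeCellRadical (K := F) (lastBlockLabel 3))))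
    {k : ↥(oppositeCellRadical (K := F) (lastBlockLabel 3))} (hk : k ∈ K) (w : W) :
    Representation.smoothIndRep (standardParabolicGL F (lastBlockLabel 3)) σ' (k : GL (Fin 3) F)
        (cellSection σ' (monotone_lastBlockLabel 3) hσ' K hKo hKc w) =
      cellSection σ' (monotone_lastBlockLabel 3) hσ' K hKo hKc w := by
  classical
  have hR : IsLeftTransversal K K ({k} : Finset ↥(oppositeCellRadical (K := F) (lastBlockLabel 3))) :=
    ⟨fun r hr => by rw [Finset.mem_singleton.1 hr]; exact hk,
      fun x hx => ⟨k, ⟨Finset.mem_singleton_self k, K.mul_mem (K.inv_mem hk) hx⟩,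
        fun r hr => Finset.mem_singleton.1 hr.1⟩⟩
  have h := cellSection_eq_sum_smoothIndRep (monotone_lastBlockLabel 3) hσ' le_rfl hKo hKc hKo hKc hR w
  rw [Finset.sum_singleton] at h
  exact h.symm

/-- **The root group moves into the vector (open orbit of the geometric lemma).** If `u₁₂(b)` normalises the
compact open `K ≤ N'`, then for `s ∈ N'` the classes of `s · Φ_{K, σ'(u₁₀ b) w}` and `s · Φ_{K, w}` in the
`U_P`-coinvariants agree: `u₁₂(b) · Φ_{K,w} = Φ_{K, σ'(u₁₀ b) w}` (`w₀ u₁₂(b) w₀⁻¹ = u₁₀(b)`), `u₁₂(b) ∈ U_P`, and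
`u₁₂(b) s = u₀₂(-s₀₁ b) s u₁₂(b)` with `u₀₂ ∈ U_P`. [cite: BernsteinZelevinskyASENS1977, Thm. 5.2 (open orbit)] -/
private theorem mk_translate_cellSection_root (b : F)
    (K : Subgroup ↥(oppositeCellRadical (K := F) (lastBlockLabel 3)))
    (hKo : IsOpen (K : Set ↥(oppositeCellRadical (K := F) (lastBlockLabel 3))))
    (hKc : IsCompact (K : Set ↥(oppositeCellRadical (K := F) (lastBlockLabel 3))))
    (hK : conjSubgroup (u12_mem_reversedParabolic b) K = K)
    {s : GL (Fin 3) F} (hs : s ∈ oppositeCellRadical (K := F) (lastBlockLabel 3)) (w : W) :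
    Representation.Coinvariants.mk
        (Representation.restrictUnipotentGL F (lastBlockLabel 3)
          (Representation.smoothIndRep (standardParabolicGL F (lastBlockLabel 3)) σ'))
        (Representation.smoothIndRep (standardParabolicGL F (lastBlockLabel 3)) σ' s
          (cellSection σ' (monotone_lastBlockLabel 3) hσ' K hKo hKc
            (σ' ⟨transvectionGL (1 : Fin 3) 0 (show (1 : Fin 3) ≠ 0 by decide) b, u10_mem_standardParabolicGL b⟩ w))) =
      Representation.Coinvariants.mk
        (Representation.restrictUnipotentGL F (lastBlockLabel 3)
          (Representation.smoothIndRep (standardParabolicGL F (lastBlockLabel 3)) σ'))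
        (Representation.smoothIndRep (standardParabolicGL F (lastBlockLabel 3)) σ' s
          (cellSection σ' (monotone_lastBlockLabel 3) hσ' K hKo hKc w)) := by
  set I := Representation.smoothIndRep (standardParabolicGL F (lastBlockLabel 3)) σ' with hI
  -- `u₁₂(b) · Φ_{K,w} = Φ_{K, σ'(u₁₀ b) w}`
  have hP : (⟨permGL Fin.revPerm * transvectionGL (1 : Fin 3) 2 (show (1 : Fin 3) ≠ 2 by decide) b * (permGL Fin.revPerm)⁻¹,
        conj_mem_standardParabolicGL_of_mem_cellLeviUnipotent (lastBlockLabel 3) (u12_mem_cellLeviUnipotent b)⟩ :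
          ↥(standardParabolicGL F (lastBlockLabel 3))) =
      ⟨transvectionGL (1 : Fin 3) 0 (show (1 : Fin 3) ≠ 0 by decide) b, u10_mem_standardParabolicGL b⟩ :=
    Subtype.ext (w₀_conj_u12 b)
  have e1 : I (transvectionGL (1 : Fin 3) 2 (show (1 : Fin 3) ≠ 2 by decide) b) (cellSection σ' (monotone_lastBlockLabel 3) hσ' K hKo hKc w) =
      cellSection σ' (monotone_lastBlockLabel 3) hσ' K hKo hKc
        (σ' ⟨transvectionGL (1 : Fin 3) 0 (show (1 : Fin 3) ≠ 0 by decide) b, u10_mem_standardParabolicGL b⟩ w) := by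
    rw [hI, smoothIndRep_levi_cellSection σ' (monotone_lastBlockLabel 3) hσ' K hKo hKc w (u12_mem_cellLeviUnipotent b),
      hP]
    exact cellSection_congr (monotone_lastBlockLabel 3) hσ' hK _ _ hKo hKc _
  -- `s u₁₂(b) = u₀₂(-s₀₁ b)⁻¹ · u₁₂(b) · s`
  have e2 : s * transvectionGL (1 : Fin 3) 2 (show (1 : Fin 3) ≠ 2 by decide) b =
      (transvectionGL (0 : Fin 3) 2 (show (0 : Fin 3) ≠ 2 by decide) (-((s : Matrix (Fin 3) (Fin 3) F) 0 1 * b)))⁻¹ *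
        (transvectionGL (1 : Fin 3) 2 (show (1 : Fin 3) ≠ 2 by decide) b * s) := by
    rw [u12_mul_of_mem hs b]
    group
  rw [← e1, ← Module.End.mul_apply, ← map_mul, e2, map_mul, Module.End.mul_apply, map_mul, Module.End.mul_apply,
    hI, mk_smoothIndRep_eq_of_mem_unipotentRadicalGL σ' (Subgroup.inv_mem _ (u02_mem_unipotentRadicalGL _)),
    mk_smoothIndRep_eq_of_mem_unipotentRadicalGL σ' (u12_mem_unipotentRadicalGL b)]

/-- **Lengthening the box multiplies the class by the index.** For `v(t) ≤ 1` and `s ∈ N'`: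
`[s · Φ_{K(γ,γ|t|⁻¹), w}] = [K(γ,γ|t|⁻¹) : K_γ] • [s · Φ_{K_γ, w}]` in the `U_P`-coinvariants (the cosets have
representatives `u₀₂(a) ∈ U_P`). [cite: BernsteinZelevinskyASENS1977, Thm. 5.2 (open orbit)] -/
private theorem exists_mk_translate_cellSection_conjBox_eq_smul {γ : ValueGroupWithZero F} (hγ : γ < 1) (hγ0 : γ ≠ 0)
    {t : Fˣ} (ht : valuation F (t : F) ≤ 1)
    {s : GL (Fin 3) F} (hs : s ∈ oppositeCellRadical (K := F) (lastBlockLabel 3)) (w : W) :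
    ∃ N : ℕ, N ≠ 0 ∧
      Representation.Coinvariants.mk
          (Representation.restrictUnipotentGL F (lastBlockLabel 3)
            (Representation.smoothIndRep (standardParabolicGL F (lastBlockLabel 3)) σ'))
          (Representation.smoothIndRep (standardParabolicGL F (lastBlockLabel 3)) σ' s
            (cellSection σ' (monotone_lastBlockLabel 3) hσ'
              (conjSubgroup (diagGL_mem_standardParabolicGL (⇑OrderDual.toDual ∘ revLabel (lastBlockLabel 3))
                (Function.update (1 : Fin 3 → Fˣ) 2 t))
                ((congruenceGL 3 γ).comap (oppositeCellRadical (K := F) (lastBlockLabel 3)).subtype))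
              (isOpen_conjSubgroup _ (isOpen_comap_congruenceGL hγ0))
              (isCompact_conjSubgroup _ (isCompact_comap_congruenceGL γ)) w)) =
        (N : ℂ) • Representation.Coinvariants.mk
          (Representation.restrictUnipotentGL F (lastBlockLabel 3)
            (Representation.smoothIndRep (standardParabolicGL F (lastBlockLabel 3)) σ'))
          (Representation.smoothIndRep (standardParabolicGL F (lastBlockLabel 3)) σ' s
            (cellSection σ' (monotone_lastBlockLabel 3) hσ'
              ((congruenceGL 3 γ).comap (oppositeCellRadical (K := F) (lastBlockLabel 3)).subtype)
              (isOpen_comap_congruenceGL hγ0) (isCompact_comap_congruenceGL γ) w)) := by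
  classical
  set I := Representation.smoothIndRep (standardParabolicGL F (lastBlockLabel 3)) σ' with hI
  set Ks : Subgroup ↥(oppositeCellRadical (K := F) (lastBlockLabel 3)) :=
    (congruenceGL 3 γ).comap (oppositeCellRadical (K := F) (lastBlockLabel 3)).subtype with hKs_def
  set Kt : Subgroup ↥(oppositeCellRadical (K := F) (lastBlockLabel 3)) :=
    conjSubgroup (diagGL_mem_standardParabolicGL (⇑OrderDual.toDual ∘ revLabel (lastBlockLabel 3))
      (Function.update (1 : Fin 3 → Fˣ) 2 t)) Ks with hKt_def
  have hle : Ks ≤ Kt := box_le_conjBox hγ ht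
  obtain ⟨R, hR⟩ := exists_isLeftTransversal (B := Kt) (T := Ks)
    (isCompact_conjSubgroup _ (isCompact_comap_congruenceGL γ)) (isOpen_comap_congruenceGL hγ0)
  rw [inf_eq_right.2 hle] at hR
  refine ⟨R.card, Finset.card_ne_zero.2 hR.nonempty, ?_⟩
  rw [cellSection_eq_sum_smoothIndRep (monotone_lastBlockLabel 3) hσ' hle
      (isOpen_conjSubgroup _ (isOpen_comap_congruenceGL hγ0)) (isCompact_conjSubgroup _ (isCompact_comap_congruenceGL γ))
      (isOpen_comap_congruenceGL hγ0) (isCompact_comap_congruenceGL γ) hR w,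
    map_sum, map_sum]
  have hterm : ∀ ρ ∈ R,
      Representation.Coinvariants.mk (Representation.restrictUnipotentGL F (lastBlockLabel 3) I)
          (I s (I ((ρ : ↥(oppositeCellRadical (K := F) (lastBlockLabel 3))) : GL (Fin 3) F)
            (cellSection σ' (monotone_lastBlockLabel 3) hσ' Ks (isOpen_comap_congruenceGL hγ0)
              (isCompact_comap_congruenceGL γ) w))) =
        Representation.Coinvariants.mk (Representation.restrictUnipotentGL F (lastBlockLabel 3) I)
          (I s (cellSection σ' (monotone_lastBlockLabel 3) hσ' Ks (isOpen_comap_congruenceGL hγ0)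
            (isCompact_comap_congruenceGL γ) w)) := by
    intro ρ hρ
    obtain ⟨a, ρ₁, hρ₁, e⟩ := exists_u02_mul_of_mem_conjBox hγ t (hR.mem_of_mem ρ hρ)
    have e' : s * (ρ : GL (Fin 3) F) = transvectionGL (0 : Fin 3) 2 (show (0 : Fin 3) ≠ 2 by decide) a * s * (ρ₁ : GL (Fin 3) F) := by
      rw [e, ← mul_assoc, mul_comm_of_mem_oppositeCellRadical (n := 2) hs (u0j_mem_oppositeCellRadical (show (0 : Fin 3) ≠ 2 by decide) a)]
    rw [← Module.End.mul_apply, ← map_mul, e', map_mul, map_mul, Module.End.mul_apply, Module.End.mul_apply, hI,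
      smoothIndRep_cellSection_of_mem σ' hσ' Ks (isOpen_comap_congruenceGL hγ0) (isCompact_comap_congruenceGL γ) hρ₁ w,
      mk_smoothIndRep_eq_of_mem_unipotentRadicalGL σ' (u02_mem_unipotentRadicalGL a)]
  rw [Finset.sum_congr rfl hterm, Finset.sum_const, ← Nat.cast_smul_eq_nsmul ℂ]


/-- **One translate of a standard section over the level box dies in the coinvariants** when the Jacquet module of
`σ'` along the root group `u₁₀(F) ≤ P` vanishes: for `s ∈ N'`, `γ < 1` and every `w ∈ W`, `[s · Φ_{K_γ, w}] = 0`.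
Writing `w = ∑ cᵢ (σ'(u₁₀ bᵢ) yᵢ - yᵢ)`, lengthen the box in the `E₀₂`-direction until `u₁₂(bᵢ)` normalises it for
all `i` (`mk_translate_cellSection_root` kills each generator there), then come back by the index
(`exists_mk_translate_cellSection_conjBox_eq_smul`). [cite: BernsteinZelevinskyASENS1977, Thm. 5.2 (open orbit)] -/
private theorem mk_translate_cellSection_box_eq_zero
    (ι : Multiplicative F →* ↥(standardParabolicGL F (lastBlockLabel 3)))
    (hι : ∀ b : F, ((ι (Multiplicative.ofAdd b) : ↥(standardParabolicGL F (lastBlockLabel 3))) : GL (Fin 3) F) =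
      transvectionGL (1 : Fin 3) 0 (show (1 : Fin 3) ≠ 0 by decide) b)
    (hJ : ∀ w : W, w ∈ Representation.Coinvariants.ker (σ'.comp ι))
    {γ : ValueGroupWithZero F} (hγ : γ < 1) (hγ0 : γ ≠ 0)
    {s : GL (Fin 3) F} (hs : s ∈ oppositeCellRadical (K := F) (lastBlockLabel 3)) (w : W) :
    Representation.Coinvariants.mk
        (Representation.restrictUnipotentGL F (lastBlockLabel 3)
          (Representation.smoothIndRep (standardParabolicGL F (lastBlockLabel 3)) σ'))
        (Representation.smoothIndRep (standardParabolicGL F (lastBlockLabel 3)) σ' s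
          (cellSection σ' (monotone_lastBlockLabel 3) hσ'
            ((congruenceGL 3 γ).comap (oppositeCellRadical (K := F) (lastBlockLabel 3)).subtype)
            (isOpen_comap_congruenceGL hγ0) (isCompact_comap_congruenceGL γ) w)) = 0 := by
  classical
  set I := Representation.smoothIndRep (standardParabolicGL F (lastBlockLabel 3)) σ' with hI
  set Ks : Subgroup ↥(oppositeCellRadical (K := F) (lastBlockLabel 3)) :=
    (congruenceGL 3 γ).comap (oppositeCellRadical (K := F) (lastBlockLabel 3)).subtype with hKs_def
  -- the long boxes `K_t = d_t K_γ d_t⁻¹` and the linear maps `Λ_t w = [s · Φ_{K_t, w}]`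
  let hd : ∀ t : Fˣ, diagGL (Fin 3) (Function.update (1 : Fin 3 → Fˣ) 2 t) ∈
      standardParabolicGL F (⇑OrderDual.toDual ∘ revLabel (lastBlockLabel 3)) := fun t =>
    diagGL_mem_standardParabolicGL _ _
  let Λ : Fˣ → W →ₗ[ℂ] (Representation.restrictUnipotentGL F (lastBlockLabel 3) I).Coinvariants := fun t =>
    Representation.Coinvariants.mk (Representation.restrictUnipotentGL F (lastBlockLabel 3) I) ∘ₗ (I s) ∘ₗ
      cellSectionₗ σ' (monotone_lastBlockLabel 3) hσ' (conjSubgroup (hd t) Ks)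
        (isOpen_conjSubgroup _ (isOpen_comap_congruenceGL hγ0)) (isCompact_conjSubgroup _ (isCompact_comap_congruenceGL γ))
  have hΛ : ∀ (t : Fˣ) (x : W), Λ t x =
      Representation.Coinvariants.mk (Representation.restrictUnipotentGL F (lastBlockLabel 3) I)
        (I s (cellSection σ' (monotone_lastBlockLabel 3) hσ' (conjSubgroup (hd t) Ks)
          (isOpen_conjSubgroup _ (isOpen_comap_congruenceGL hγ0)) (isCompact_conjSubgroup _ (isCompact_comap_congruenceGL γ)) x)) :=
    fun t x => rfl
  -- every generator `σ'(u₁₀ b) y - y` is killed by `Λ_t` as soon as `v(b t) ≤ 1`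
  have hgen : ∀ (b : F) (y : W) (t : Fˣ), valuation F (b * (t : F)) ≤ 1 →
      Λ t (σ' (ι (Multiplicative.ofAdd b)) y - y) = 0 := by
    intro b y t hbt
    have hιb : ι (Multiplicative.ofAdd b) = ⟨transvectionGL (1 : Fin 3) 0 (show (1 : Fin 3) ≠ 0 by decide) b, u10_mem_standardParabolicGL b⟩ :=
      Subtype.ext (hι b)
    rw [map_sub, hΛ, hΛ, hιb, hI,
      mk_translate_cellSection_root σ' hσ' b _ _ _ (conjSubgroup_u12_conjBox hγ t hbt) hs y, sub_self]
  -- span induction: `w ↦ ∃ t, ∀ t', v t' ≤ v t → Λ_{t'} w = 0`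
  have key : ∀ x : W, x ∈ Representation.Coinvariants.ker (σ'.comp ι) →
      ∃ t : Fˣ, ∀ t' : Fˣ, valuation F (t' : F) ≤ valuation F (t : F) → Λ t' x = 0 := by
    intro x hx
    unfold Representation.Coinvariants.ker at hx
    induction hx using Submodule.span_induction with
    | mem x hx =>
      obtain ⟨⟨g, y⟩, rfl⟩ := hx
      set b : F := Multiplicative.toAdd g with hb_def
      have hg : g = Multiplicative.ofAdd b := rfl
      by_cases hb : b = 0
      · refine ⟨1, fun t' _ => ?_⟩
        show Λ t' (σ' (ι g) y - y) = 0
        rw [hg]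
        refine hgen b y t' ?_
        rw [hb, zero_mul, map_zero]
        exact zero_le_one
      · refine ⟨(Units.mk0 b hb)⁻¹, fun t' ht' => ?_⟩
        show Λ t' (σ' (ι g) y - y) = 0
        rw [hg]
        refine hgen b y t' ?_
        rw [map_mul]
        calc valuation F b * valuation F (t' : F)
            ≤ valuation F b * valuation F (((Units.mk0 b hb)⁻¹ : Fˣ) : F) := by gcongr
          _ = 1 := by rw [← map_mul, Units.val_inv_eq_inv_val, Units.val_mk0, mul_inv_cancel₀ hb, map_one]
    | zero => exact ⟨1, fun t' _ => map_zero _⟩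
    | add x y _ _ ihx ihy =>
      obtain ⟨t₁, h₁⟩ := ihx
      obtain ⟨t₂, h₂⟩ := ihy
      by_cases h : valuation F (t₁ : F) ≤ valuation F (t₂ : F)
      · exact ⟨t₁, fun t' ht' => by rw [map_add, h₁ t' ht', h₂ t' (ht'.trans h), add_zero]⟩
      · exact ⟨t₂, fun t' ht' => by rw [map_add, h₁ t' (ht'.trans (le_of_not_ge h)), h₂ t' ht', add_zero]⟩
    | smul a x _ ihx =>
      obtain ⟨t, ht⟩ := ihx
      exact ⟨t, fun t' ht' => by rw [map_smul, ht t' ht', smul_zero]⟩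
  -- conclude: take `t'` with `v t' ≤ v t` and `v t' ≤ 1`
  obtain ⟨t, ht⟩ := key w (hJ w)
  obtain ⟨t', ht't, ht'1⟩ : ∃ t' : Fˣ, valuation F (t' : F) ≤ valuation F (t : F) ∧ valuation F (t' : F) ≤ 1 := by
    by_cases h : valuation F (t : F) ≤ 1
    · exact ⟨t, le_rfl, h⟩
    · exact ⟨1, by rw [Units.val_one, map_one]; exact le_of_not_ge h, by rw [Units.val_one, map_one]⟩
  have h0 := ht t' ht't
  obtain ⟨N, hN, hN'⟩ := exists_mk_translate_cellSection_conjBox_eq_smul σ' hσ' hγ hγ0 ht'1 hs w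
  rw [hΛ, hI, hN'] at h0
  exact (smul_eq_zero.1 h0).resolve_left (Nat.cast_ne_zero.2 hN)

/-- **The open orbit contributes nothing to `Hom_P(Ind σ'|_P, σ')` when `σ'` is cuspidal along `u₁₀(F)`
(`W`-valued form of the geometric lemma for `(Q_{2,1}, Q_{2,1})`, Bernstein–Zelevinsky 1977, Thm. 5.2).**
Let `F` be a non-archimedean local field, `P = Q_{2,1} ≤ GL₃(F)` the standard maximal parabolic, `σ'` a smooth
representation of `P` on `W` and `ι : F → P`, `b ↦ u₁₀(b) = 1 + b E₁₀`, the root group of the `GL₂`-block of the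
Levi OPPOSITE to the one moved into `U_P` by `w₀` (`w₀ u₁₂(b) w₀⁻¹ = u₁₀(b)`).  If the Jacquet module of `σ'`
along `u₁₀(F)` vanishes (`W = ⟨σ'(u₁₀ b) y - y⟩`), then every `f ∈ Ind_P^{GL₃} σ'` supported on the open cell
`P w₀ N'` (i.e. vanishing on `cellLT`) has class `0` in the `U_P`-coinvariants of `Ind_P^{GL₃} σ'`.
In the geometric lemma `r_P ∘ i_P (σ ⊠ χ′)` is glued from `σ ⊠ χ′` (closed orbit) and
`i ∘ w ∘ r_{N̄₂}(σ) ⊠ χ′` (open orbit); the second term vanishes for `σ` supercuspidal — this is that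
vanishing, proved on standard sections: `f = ∑ r⁻¹ · Φ_{K_γ, w_r}` (★ `exists_eq_sum_cellSection`) and each
translate dies (`mk_translate_cellSection_box_eq_zero`). [cite: BernsteinZelevinskyASENS1977, Thm. 5.2 and §7.1]
[cite: Casselman1995, Prop. 6.3.1–6.3.3] -/
theorem mk_restrictUnipotentGL_eq_zero_of_mem_vanishingOn_of_jacquet_root
    {F : Type*} [Field F] [ValuativeRel F] [TopologicalSpace F] [IsNonarchimedeanLocalField F]
    {W : Type*} [AddCommGroup W] [Module ℂ W]
    (σ' : Representation ℂ ↥(standardParabolicGL F (lastBlockLabel 3)) W) (hσ' : σ'.IsSmooth)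
    (ι : Multiplicative F →* ↥(standardParabolicGL F (lastBlockLabel 3)))
    (hι : ∀ b : F, ((ι (Multiplicative.ofAdd b) : ↥(standardParabolicGL F (lastBlockLabel 3))) : GL (Fin 3) F) =
      transvectionGL (1 : Fin 3) 0 (by decide) b)
    (hJ : ∀ w : W, w ∈ Representation.Coinvariants.ker (σ'.comp ι))
    (f : Representation.SmoothInd (standardParabolicGL F (lastBlockLabel 3)) σ')
    (hf : f ∈ vanishingOn (standardParabolicGL F (lastBlockLabel 3)) σ' (cellLT (K := F) (lastBlockLabel 3) Fin.revPerm)) :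
    Representation.Coinvariants.mk
        (Representation.restrictUnipotentGL F (lastBlockLabel 3)
          (Representation.smoothIndRep (standardParabolicGL F (lastBlockLabel 3)) σ')) f = 0 := by
  classical
  -- a uniformizer and the level box `K_γ = N' ∩ K_{ϖ^m}` fixing `f`
  obtain ⟨ϖ, hϖ⟩ := exists_isUniformizingElement (F := F)
  obtain ⟨m, hm1, hstab⟩ := exists_congruenceGL_pow_subset (n := 3) hϖ
    ((Representation.isSmooth_smoothInd (standardParabolicGL F (lastBlockLabel 3)) σ' f).mem_nhds
      (Subgroup.one_mem _))
  have hγ0 : valuation F ϖ ^ m ≠ 0 := pow_ne_zero _ ((Valuation.ne_zero_iff _).mpr hϖ.ne_zero)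
  have hγ1 : valuation F ϖ ^ m < 1 := hϖ.valuation_pow_lt_one hm1
  set K' : Subgroup ↥(oppositeCellRadical (K := F) (lastBlockLabel 3)) :=
    (congruenceGL 3 (valuation F ϖ ^ m)).comap (oppositeCellRadical (K := F) (lastBlockLabel 3)).subtype
    with hK'_def
  have hK'stab : ∀ k ∈ K', ∀ x : GL (Fin 3) F, f.toFun (x * (k : GL (Fin 3) F)) = f.toFun x := fun k hk x =>
    toFun_w₀_mul_mul_of_mem_stabilizer (hstab hk) x
  -- the decomposition of `f` into translates of standard sections
  obtain ⟨R, hR⟩ := exists_eq_sum_cellSection σ' (monotone_lastBlockLabel 3) hσ' K'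
    (isOpen_comap_congruenceGL hγ0) (isCompact_comap_congruenceGL _) f hf hK'stab
  -- `N'` is abelian, so the conjugates of `K'` by elements of `N'` are `K'`
  have hconjK : ∀ r : ↥(oppositeCellRadical (K := F) (lastBlockLabel 3)),
      conjSubgroup (oppositeCellRadical_le_reversedParabolic (lastBlockLabel 3) r.2) K' = K' := by
    intro r
    ext x
    rw [mem_conjSubgroup_iff]
    have : (radicalConj (oppositeCellRadical_le_reversedParabolic (lastBlockLabel 3) r.2)).symm x = x :=
      Subtype.ext (by
        rw [coe_radicalConj_symm, mul_assoc, mul_comm_of_mem_oppositeCellRadical (n := 2) x.2 r.2, ← mul_assoc,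
          inv_mul_cancel, one_mul])
    rw [this]
  rw [hR, map_sum]
  refine Finset.sum_eq_zero fun r _ => ?_
  rw [cellSection_congr (monotone_lastBlockLabel 3) hσ' (hconjK r) (isOpen_conjSubgroup _ (isOpen_comap_congruenceGL hγ0))
    (isCompact_conjSubgroup _ (isCompact_comap_congruenceGL _)) (isOpen_comap_congruenceGL hγ0)
    (isCompact_comap_congruenceGL _), ← Subgroup.coe_inv]
  exact mk_translate_cellSection_box_eq_zero σ' hσ' ι hι hJ hγ1 hγ0 (r⁻¹).2 _

end Coinvariants


end Summit.HodgeConjecture.HodgeConjecture.R90.S1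

end
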